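/-
Copyright (c) 2026 the pub-hodgecm-mathlib formalisation cell (harness21).  Prover seat hodgecm-mathlib-K2Liu-p14 (g0): Track B «K2-LIT»,
hLiu418 = stmt-HodgeConjecture-24832; LEAD F0P6-plan (g12) RULINGS M-156m ∕ M-156o «A7 = GK COCYCLE ROAD; ONE BOOKKEEPER», file B6 §4.
-/
import Summits.HodgeConjecture.HodgeConjecture.Theorems.K2LiuRankOneFamilies         -- ★ B6 §1–§3: `eq_lFactor_mul_of_head_tail`, `isQRationalRegularAt_normalForm_headSum`
import Summits.HodgeConjecture.HodgeConjecture.Theorems.K2LiuRankOneLevelHolomorphy   -- ★ B5b: `integrable_and_integral_eq` (one rank-one integral at level `K′`, closed form)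
import HarnessLib

/-!
# Crux `HLiu418`, road `K2_Liu`, organ A7-reg (GK cocycle road), file B6 §4:
# THE LEVEL-`K′` FAMILY THEOREM — B5's rank-one integral ALONG A FAMILY is «`L`-factor × normal form», normal form regular at `s₀`

Cell `hodgecm-mathlib`, crux item hLiu418 = `stmt-HodgeConjecture-24832`; squad K2 ∕ K2Liu; prover K2Liu-p14 (g0).
THEOREMS ONLY (no `def`, no instance, no notation, no named-fact hypothesis, no `sorry`); lane `--supports stmt-HodgeConjecture-24832`
(count-neutral helper).  Sibling of ★ B6 `K2LiuRankOneFamilies` (§1–§3, group-free and measure-free): this §4 plugs ★ B5b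
`K2LiuRankOneLevelHolomorphy.integrable_and_integral_eq` (K2Liu-p09 (g5)) into B6's by-value factorisation BY NAME.

THE STATEMENT.  At a completion `K_w` with an additive Haar measure `μ`, fix the level data `(m, r, R)` (`𝔭^{−m} = ⨆_{y∈R}(y + 𝔭^r)`), a unitary
character `ν` of `K_wˣ`, and a parameter set `S` with `1 < re e(s)` on `S` (absolute convergence).  Let `Ψ : ℂ → K_w → ℂ` be a FAMILY of
rank-one integrands (`Ψ s x = f_s(w_α u_α(x) h)` at use — file B3's letter) which for every `s ∈ S` has B5's shape: measurable, constant on the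
translates `y + 𝔭^r` (`y ∈ R`) — the HEAD —, and equal to `C(s) · ν(u)⁻¹ · ‖u‖^{−e(s)}` off `𝔭^{−m}` — the TAIL.  Then for every `s ∈ S`
  **`Ψ s ∈ L¹(μ)` and `∫ Ψ s dμ = L(e(s) − 1, ν) · N(s)`**,  `N(s) = (1 − unramValue ν · q_w^{1−e(s)}) · Σ_{y∈R} μ(𝔭^r) Ψ s y + C(s)(1 − q_w⁻¹) μ(𝒪_w) ·
  (unramValue ν · q_w^{1−e(s)})^{m+1}` (the NORMAL FORM `N_α f_s` of RULING M-156o, written inline — never dividing by `L`),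
and **`N` is `q_w^{-s}`-rational and regular at `s₀`** as soon as the finitely many head-value families `s ↦ Ψ s y` (`y ∈ R`) and the tail
constant `C` are, for an affine exponent `e(s) = a s + c₀` (`a ∈ ℕ`); `s₀` arbitrary (⇒ «entire» version).  Packaged: `∃ Fn` regular at `s₀`
with `∫ Ψ s = L(e(s) − 1, ν) · Fn s` on `S` — the sentence of the repaired face (A4′-R) for ONE rank-one factor of the cocycle
`M_w(s) = A₂ ∘ A₁ ∘ A₂` (`s₀ = ½`, `S = {1 < re s}` at use; B7 `K2LiuA7NormalisedRegularity` multiplies three normal forms).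
HONEST LABEL.  `HC_CM` is proved only modulo the 7 printed citations (2 remaining named inputs: hLiu418 = `stmt-HodgeConjecture-24832`,
h413 = `stmt-HodgeConjecture-24833`) until rung 0 closes.

## References
* [Casselman1980] W. Casselman, *The unramified principal series of p-adic groups I*, Compositio Math. 40 (1980), §3 Thm. 3.1 (rank-one `c_α(λ)`;
  `T_w` rational in `q^{-s}` on `K′`-fixed vectors).
* [KudlaSweet1997] S. Kudla, W. J. Sweet, Israel J. Math. 98 (1997), §1 (the normalised intertwining operator is entire).
* [Tate1950] J. Tate, *Fourier analysis in number fields and Hecke's zeta-functions* (1950), §2.4–2.5 (shell sums, local factors).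
-/

set_option autoImplicit false
set_option linter.dupNamespace false -- the mandated namespace repeats `HodgeConjecture.HodgeConjecture`

noncomputable section

open MeasureTheory NumberField IsDedekindDomain
open scoped NNReal
open Literature.NumberTheory.GaloisRepresentations Literature.NumberTheory.GaloisRepresentations.IsNonarchimedeanLocalField
open Literature.NumberTheory.Automorphic
open Summit.HodgeConjecture.HodgeConjecture.Cruxes.HLiu418.K2LiuQRationalDefs
open Summit.HodgeConjecture.HodgeConjecture.Cruxes.HLiu418.K2LiuLocalLFactorDefs
open Summit.HodgeConjecture.HodgeConjecture.Cruxes.HLiu418.K2LiuQRationalLFactor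
open Summit.HodgeConjecture.HodgeConjecture.Cruxes.HLiu418.K2LiuRankOneFamilies
open Summit.HodgeConjecture.HodgeConjecture.Cruxes.HLiu418.K2LiuRankOneLevelHolomorphy

namespace Summit.HodgeConjecture.HodgeConjecture.Cruxes.HLiu418.K2LiuRankOneFamiliesLevel

variable {K : Type} [Field K] [NumberField K] {w : HeightOneSpectrum (𝓞 K)}
  [MeasurableSpace (w.adicCompletion K)] [BorelSpace (w.adicCompletion K)]

/-! ## §4 The level-`K′` family theorem -/

/-- **`∫ Ψ s dμ = L(e(s) − 1, ν) · N(s)` on `S`, with the EXPLICIT normal form `N`** (B5b's closed formula for each `s ∈ S` — level data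
`(m, r, R)` and `ν` FIXED along the family — rewritten «never dividing by `L`» through ★ B6 `eq_lFactor_mul_of_head_tail`).
[cite: Casselman1980, §3 Thm. 3.1] [cite: KudlaSweet1997, §1] [cite: Tate1950, §2.4–2.5] -/
theorem integrable_and_integral_eq_lFactor_mul_normalForm (μ : Measure (w.adicCompletion K)) [μ.IsAddHaarMeasure] (m : ℕ) {r : ℤ}
    (R : Finset (w.adicCompletion K)) (hRinc : ∀ y ∈ R, ∀ y' ∈ R, y ≠ y' → y - y' ∉ primePowBall (w.adicCompletion K) r)
    (hRcov : primePowBall (w.adicCompletion K) (-(m : ℤ)) = ⋃ y ∈ R, {x | x - y ∈ primePowBall (w.adicCompletion K) r})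
    (S : Set ℂ) (Ψ : ℂ → w.adicCompletion K → ℂ) (hΨm : ∀ s ∈ S, AEStronglyMeasurable (Ψ s) μ)
    (hhead : ∀ s ∈ S, ∀ y ∈ R, ∀ x, x - y ∈ primePowBall (w.adicCompletion K) r → Ψ s x = Ψ s y)
    (ν : (w.adicCompletion K)ˣ →* ℂˣ) (hν : ∀ u, ‖((ν u : ℂˣ) : ℂ)‖ = 1) (C e : ℂ → ℂ) (hS : ∀ s ∈ S, 1 < (e s).re)
    (htail : ∀ s ∈ S, ∀ u : (w.adicCompletion K)ˣ, (u : w.adicCompletion K) ∉ primePowBall (w.adicCompletion K) (-(m : ℤ)) →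
      Ψ s u = C s * (((ν u)⁻¹ : ℂˣ) : ℂ) * ((normAbs (w.adicCompletion K) (u : w.adicCompletion K) : ℝ) : ℂ) ^ (-e s))
    {s : ℂ} (hs : s ∈ S) :
    Integrable (Ψ s) μ ∧ ∫ x, Ψ s x ∂μ = lFactor K w ν (e s - 1) *
      ((1 - unramValue K w ν * (residueFieldCard (w.adicCompletion K) : ℂ) ^ (1 - e s)) *
          (∑ y ∈ R, (μ.real (primePowBall (w.adicCompletion K) r) : ℂ) * Ψ s y) +
        C s * (1 - (residueFieldCard (w.adicCompletion K) : ℂ)⁻¹) * μ.real (primePowBall (w.adicCompletion K) 0) *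
          (unramValue K w ν * (residueFieldCard (w.adicCompletion K) : ℂ) ^ (1 - e s)) ^ (m + 1)) := by
  have hB5 : ∀ s ∈ S, Integrable (Ψ s) μ ∧ ∫ x, Ψ s x ∂μ =
      (∑ y ∈ R, (μ.real (primePowBall (w.adicCompletion K) r) : ℂ) * Ψ s y) +
        C s * (1 - (residueFieldCard (w.adicCompletion K) : ℂ)⁻¹) * μ.real (primePowBall (w.adicCompletion K) 0) *
          ((unramValue K w ν * (residueFieldCard (w.adicCompletion K) : ℂ) ^ (1 - e s)) ^ (m + 1) * lFactor K w ν (e s - 1)) :=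
    fun s hs => integrable_and_integral_eq μ m R hRinc hRcov (Ψ s) (hΨm s hs) (hhead s hs) ν hν (C s) (e s) (hS s hs) (htail s hs)
  refine ⟨(hB5 s hs).1, ?_⟩
  exact eq_lFactor_mul_of_head_tail (norm_unramValue_le_one hν) e S hS (fun s => ∫ x, Ψ s x ∂μ)
    (fun s => ∑ y ∈ R, (μ.real (primePowBall (w.adicCompletion K) r) : ℂ) * Ψ s y)
    (fun s => C s * (1 - (residueFieldCard (w.adicCompletion K) : ℂ)⁻¹) * μ.real (primePowBall (w.adicCompletion K) 0)) m
    (fun s hs => (hB5 s hs).2) hs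

omit [BorelSpace (w.adicCompletion K)] in
/-- **the normal form `N` is regular at `s₀`** for an affine exponent `e(s) = a s + c₀` (`a ∈ ℕ`) when the head-value families `s ↦ Ψ s y`
(`y ∈ R`) and the tail constant `C` are — no convergence and no measure hypothesis (★ B6 `isQRationalRegularAt_normalForm_headSum`).
[cite: Casselman1980, §3 Thm. 3.1] [cite: KudlaSweet1997, §1] -/
theorem isQRationalRegularAt_levelNormalForm (μ : Measure (w.adicCompletion K)) (m : ℕ) (r : ℤ) (R : Finset (w.adicCompletion K))
    (ν : (w.adicCompletion K)ˣ →* ℂˣ) {C e : ℂ → ℂ} {Ψ : ℂ → w.adicCompletion K → ℂ} {s₀ : ℂ} (a : ℕ) (c₀ : ℂ)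
    (he : ∀ s, e s = (a : ℂ) * s + c₀)
    (hΨ : ∀ y ∈ R, IsQRationalRegularAt (residueFieldCard (w.adicCompletion K)) s₀ fun s => Ψ s y)
    (hC : IsQRationalRegularAt (residueFieldCard (w.adicCompletion K)) s₀ C) :
    IsQRationalRegularAt (residueFieldCard (w.adicCompletion K)) s₀ fun s =>
      (1 - unramValue K w ν * (residueFieldCard (w.adicCompletion K) : ℂ) ^ (1 - e s)) *
          (∑ y ∈ R, (μ.real (primePowBall (w.adicCompletion K) r) : ℂ) * Ψ s y) +
        C s * (1 - (residueFieldCard (w.adicCompletion K) : ℂ)⁻¹) * μ.real (primePowBall (w.adicCompletion K) 0) *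
          (unramValue K w ν * (residueFieldCard (w.adicCompletion K) : ℂ) ^ (1 - e s)) ^ (m + 1) :=
  isQRationalRegularAt_normalForm_headSum ν R _ _ _ m a c₀ he hΨ hC

/-- **PACKAGED — the (A4′-R)-shaped sentence for ONE rank-one factor at level `K′`**: under B5's hypotheses along the family (level data and
`ν` fixed, `1 < re e(s)` on `S`), an affine exponent and head values ∕ tail constant regular at `s₀`, there is `Fn` regular at `s₀` with
`Ψ s ∈ L¹` and `∫ Ψ s = L(e(s) − 1, ν) · Fn(s)` for every `s ∈ S`. [cite: Casselman1980, §3 Thm. 3.1] [cite: KudlaSweet1997, §1] -/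
theorem exists_regular_factorisation_of_level (μ : Measure (w.adicCompletion K)) [μ.IsAddHaarMeasure] (m : ℕ) {r : ℤ}
    (R : Finset (w.adicCompletion K)) (hRinc : ∀ y ∈ R, ∀ y' ∈ R, y ≠ y' → y - y' ∉ primePowBall (w.adicCompletion K) r)
    (hRcov : primePowBall (w.adicCompletion K) (-(m : ℤ)) = ⋃ y ∈ R, {x | x - y ∈ primePowBall (w.adicCompletion K) r})
    (S : Set ℂ) (Ψ : ℂ → w.adicCompletion K → ℂ) (hΨm : ∀ s ∈ S, AEStronglyMeasurable (Ψ s) μ)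
    (hhead : ∀ s ∈ S, ∀ y ∈ R, ∀ x, x - y ∈ primePowBall (w.adicCompletion K) r → Ψ s x = Ψ s y)
    (ν : (w.adicCompletion K)ˣ →* ℂˣ) (hν : ∀ u, ‖((ν u : ℂˣ) : ℂ)‖ = 1) (C e : ℂ → ℂ) (hS : ∀ s ∈ S, 1 < (e s).re)
    (htail : ∀ s ∈ S, ∀ u : (w.adicCompletion K)ˣ, (u : w.adicCompletion K) ∉ primePowBall (w.adicCompletion K) (-(m : ℤ)) →
      Ψ s u = C s * (((ν u)⁻¹ : ℂˣ) : ℂ) * ((normAbs (w.adicCompletion K) (u : w.adicCompletion K) : ℝ) : ℂ) ^ (-e s))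
    {s₀ : ℂ} (a : ℕ) (c₀ : ℂ) (he : ∀ s, e s = (a : ℂ) * s + c₀)
    (hΨ : ∀ y ∈ R, IsQRationalRegularAt (residueFieldCard (w.adicCompletion K)) s₀ fun s => Ψ s y)
    (hC : IsQRationalRegularAt (residueFieldCard (w.adicCompletion K)) s₀ C) :
    ∃ Fn : ℂ → ℂ, IsQRationalRegularAt (residueFieldCard (w.adicCompletion K)) s₀ Fn ∧
      ∀ s ∈ S, Integrable (Ψ s) μ ∧ ∫ x, Ψ s x ∂μ = lFactor K w ν (e s - 1) * Fn s :=
  ⟨_, isQRationalRegularAt_levelNormalForm μ m r R ν a c₀ he hΨ hC, fun _ hs =>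
    integrable_and_integral_eq_lFactor_mul_normalForm μ m R hRinc hRcov S Ψ hΨm hhead ν hν C e hS htail hs⟩

/-- **ENTIRE version**: head values and tail constant regular at EVERY `s₀` give one `Fn` regular at every `s₀` (the normalised rank-one
operator maps «entire» level-`K′` families to «entire» ones). [cite: Casselman1980, §3 Thm. 3.1] [cite: KudlaSweet1997, §1] -/
theorem exists_entire_factorisation_of_level (μ : Measure (w.adicCompletion K)) [μ.IsAddHaarMeasure] (m : ℕ) {r : ℤ}
    (R : Finset (w.adicCompletion K)) (hRinc : ∀ y ∈ R, ∀ y' ∈ R, y ≠ y' → y - y' ∉ primePowBall (w.adicCompletion K) r)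
    (hRcov : primePowBall (w.adicCompletion K) (-(m : ℤ)) = ⋃ y ∈ R, {x | x - y ∈ primePowBall (w.adicCompletion K) r})
    (S : Set ℂ) (Ψ : ℂ → w.adicCompletion K → ℂ) (hΨm : ∀ s ∈ S, AEStronglyMeasurable (Ψ s) μ)
    (hhead : ∀ s ∈ S, ∀ y ∈ R, ∀ x, x - y ∈ primePowBall (w.adicCompletion K) r → Ψ s x = Ψ s y)
    (ν : (w.adicCompletion K)ˣ →* ℂˣ) (hν : ∀ u, ‖((ν u : ℂˣ) : ℂ)‖ = 1) (C e : ℂ → ℂ) (hS : ∀ s ∈ S, 1 < (e s).re)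
    (htail : ∀ s ∈ S, ∀ u : (w.adicCompletion K)ˣ, (u : w.adicCompletion K) ∉ primePowBall (w.adicCompletion K) (-(m : ℤ)) →
      Ψ s u = C s * (((ν u)⁻¹ : ℂˣ) : ℂ) * ((normAbs (w.adicCompletion K) (u : w.adicCompletion K) : ℝ) : ℂ) ^ (-e s))
    (a : ℕ) (c₀ : ℂ) (he : ∀ s, e s = (a : ℂ) * s + c₀)
    (hΨ : ∀ s₀, ∀ y ∈ R, IsQRationalRegularAt (residueFieldCard (w.adicCompletion K)) s₀ fun s => Ψ s y)
    (hC : ∀ s₀, IsQRationalRegularAt (residueFieldCard (w.adicCompletion K)) s₀ C) :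
    ∃ Fn : ℂ → ℂ, (∀ s₀, IsQRationalRegularAt (residueFieldCard (w.adicCompletion K)) s₀ Fn) ∧
      ∀ s ∈ S, Integrable (Ψ s) μ ∧ ∫ x, Ψ s x ∂μ = lFactor K w ν (e s - 1) * Fn s :=
  ⟨_, fun s₀ => isQRationalRegularAt_levelNormalForm μ m r R ν a c₀ he (hΨ s₀) (hC s₀), fun _ hs =>
    integrable_and_integral_eq_lFactor_mul_normalForm μ m R hRinc hRcov S Ψ hΨm hhead ν hν C e hS htail hs⟩

omit [BorelSpace (w.adicCompletion K)] in
/-- **where the `L`-factor is alive-regular** (`1 < re e(s₀)`, e.g. the first two cocycle factors at `s₀ = ½`): the continuation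
`s ↦ L(e(s) − 1, ν) · N(s)` of `s ↦ ∫ Ψ s` is itself regular at `s₀`. [cite: Casselman1980, §3 Thm. 3.1] [cite: KudlaSweet1997, §1] -/
theorem isQRationalRegularAt_lFactor_mul_levelNormalForm (μ : Measure (w.adicCompletion K)) (m : ℕ) (r : ℤ)
    (R : Finset (w.adicCompletion K)) (ν : (w.adicCompletion K)ˣ →* ℂˣ) (hν : ∀ u, ‖((ν u : ℂˣ) : ℂ)‖ = 1)
    {C e : ℂ → ℂ} {Ψ : ℂ → w.adicCompletion K → ℂ} {s₀ : ℂ} (a : ℕ) (c₀ : ℂ) (he : ∀ s, e s = (a : ℂ) * s + c₀) (h0 : 1 < (e s₀).re)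
    (hΨ : ∀ y ∈ R, IsQRationalRegularAt (residueFieldCard (w.adicCompletion K)) s₀ fun s => Ψ s y)
    (hC : IsQRationalRegularAt (residueFieldCard (w.adicCompletion K)) s₀ C) :
    IsQRationalRegularAt (residueFieldCard (w.adicCompletion K)) s₀ fun s => lFactor K w ν (e s - 1) *
      ((1 - unramValue K w ν * (residueFieldCard (w.adicCompletion K) : ℂ) ^ (1 - e s)) *
          (∑ y ∈ R, (μ.real (primePowBall (w.adicCompletion K) r) : ℂ) * Ψ s y) +
        C s * (1 - (residueFieldCard (w.adicCompletion K) : ℂ)⁻¹) * μ.real (primePowBall (w.adicCompletion K) 0) *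
          (unramValue K w ν * (residueFieldCard (w.adicCompletion K) : ℂ) ^ (1 - e s)) ^ (m + 1)) :=
  isQRationalRegularAt_lFactor_mul_normalForm (norm_unramValue_le_one hν) (isQRationalRegularAt_cpow_one_sub_of_affine a c₀ he s₀) h0
    (isQRationalRegularAt_levelNormalForm μ m r R ν a c₀ he hΨ hC)

end Summit.HodgeConjecture.HodgeConjecture.Cruxes.HLiu418.K2LiuRankOneFamiliesLevel

end
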